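import Summits.QuantumFields.YangMills.Theorems.UnitScaleTiltProp7CoerciveRawSlotOfGaugeFixedLift
import Summits.QuantumFields.YangMills.Theorems.UnitScaleTiltProp7TJL2BoundOfSupRow
import HarnessLib

/-!
# Route `UnitScaleTilt`, crux «MinimiserStabilityRegPr» (stmt-QuantumFields-19200, stub EX), node N06(d = 3), route (α) — **THE POSITIVITY-BLOCK DOOR OF THE EX FACE
# BEHIND THE LIFT ANTECEDENT: the three [B9] Thm 3.11 print rows `hPos₁ hPosπ hPosΔ` IN THEIR LIFT-THREAD 2 TEXTS (`Lift L i U₀ →` inserted after `ρ ≤ αcap L →`,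
# ★★OWNER RULING №30 (ii)) FROM ONE GAUGE-FIXED SLICE ROW `γ`, THE FACE'S FORMER SUP-ROW `hTJ`, THE LIFT ROW `hLiftRec`, AND NUMERIC WINDOWS**

Cell `ym3-torus` (HUMAN RULING D-0037, YM ladder rung R3 — YM₃ on T³ is a RUNG, NOT d = 4, NOT the Clay problem; the YM mass gap is NOT proved).  Fleet lead seat
`ym-ust-19200-p1` (gen 22), positivity-block lane of the EX face — the door that knits this seat's three files ✓`Prop7CoerciveOfGaugeFixedLift` (p736656),
✓`Prop7PureGaugeCurlCurvature` (p737382) ∕ ✓`Prop7CoerciveRawSlotOfGaugeFixedLift` (p737970), ✓`Prop7TJL2BoundOfSupRow`, with ★p1 g21 ✓`Prop7PosOfGaugeFixed` (p731635).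
THEOREMS ONLY (0 `def`, 0 `sorry`); `--supports stmt-QuantumFields-19200 --as helper`; count-neutral.  A DOOR for the EX namer (w2 lineage): whether a later S-event trades the three
print rows for the γ-row is the namer's ∕ OWNER's decision, not this file's.

THE PRINT.  [Balaban1985BackgroundPropagators] Thm 3.11 p. 416 *«the operators Δ′_a, G′, (Q′G′²Q′*)⁻¹, Δ_a, G are positive definite»*; (3.118)–(3.122) pp. 419–420 (gauge-fixed
reduction); (3.127)–(3.128) p. 421 (`Δ₁ = Pᵀ(Δ + T_J)P`); (3.26) p. 395.  [Balaban1985Variational] (141)–(142) p. 299.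

WHAT IS PROVED (ns `…Theorems.Prop7PositivityBlockDoorLift`).
* ★★★ `positivityRows_lift_of_gaugeFixedRow` — for an OPAQUE lift letter `Lift` with the row `hLiftRec : Lift L i U₀ → ⟨lifting predicate of record⟩`, a regularity cap `αcap` with
  `10¹²L³·αcap L ≤ 1`, the gauge-fixed slice row `hGF : ∀ ρ ≤ αcap L, RegPr ρ U₀ → ∀ A, R_S D* A = 0 → γ L i‖A‖² ≤ re⟨A, Δ^η(U₀)A⟩ + a‖Q_kA‖²`, the sup-row `hTJ` of `T_Jᴾ` at
  radius `αcap L` (S23ᴸ text, constant `kTJ L ≥ 0`), and the member windows `4·kTJ + 1029·αcap < γ`… precisely `hwin₁ : 4 kTJ L + 1029 αcap L ≤ γ L i`,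
  `hwin₂ : 288 (αcap L)² + 4 kTJ L ≤ 1`, `hwin₃ : 4·1029·αcap L < min (γ L i − 4 kTJ L − 1029 αcap L) (1 − 288 (αcap L)² − 4 kTJ L)`:
  THE CONJUNCTION `hPos₁[Lift] ∧ hPosπ[Lift] ∧ hPosΔ[Lift]` of the three S43ᴸT2 binder texts (slots `DeltaOnePJ`, `DeltaPiSlotP`, `DeltaEtaSlot + TJSlotP`).
  `hPosπ`: slice positivity from `γ > 0` (✓`pos_laplaceA_DeltaPiSlotP_iff`); `hPos₁`: slice floor `γ − kTJ > 0` at slot `Δ^η + T_J` (✓`gaugeFixedFloor_add_of_bound` ∘ ✓`tauRow_TJP_of_supRow`,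
  ✓`pos_laplaceA_DeltaOnePJ_iff`); `hPosΔ`: ✓`hPosΔ_lift_of_gaugeFixedRow` fed with the same two rows.  `Lift` is USED only for `hPosΔ` (the other two hold without it; the
  antecedent is carried because the S43ᴸT2 texts carry it).
* ★★★ `positivityRows_liftRecord_of_gaugeFixedRow` — the same at `Lift :=` the lifting predicate OF RECORD (`hLiftRec := fun _ _ _ h => h`): the three conjuncts are then the
  S43ᴸT2 binder texts VERBATIM (the `Lift` clause spelled out, SIGNATURE-0 `…S43LT2-LiftThread2-face` ll.141–170).
HONEST SCOPE.  Composition; no estimate of print is proved; the γ-row (curved gauge-fixed slice floor = Thm 3.3∕3.11 proper), `h133`∕`hC157` (behind `hTJ`), the other print rows,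
`hThm2S`, EX, the crux are NOT proved; nothing continuum ∕ OS ∕ mass-gap ∕ Clay.

References: T. Bałaban, CMP **99** (1985) 389–434 [Balaban1985BackgroundPropagators] (Thm 3.11 p.416, (3.26) p.395, (3.118)–(3.122) pp.419–420, (3.127)–(3.128) p.421,
(3.137) p.423); CMP **102** (1985) 277–309 [Balaban1985Variational] ((141)–(142) p.299).
-/

set_option autoImplicit false

noncomputable section

open scoped InnerProductSpace ComplexConjugate Matrix.Norms.L2Operator BigOperators

namespace Summit.QuantumFields.YangMills.Theorems.Prop7PositivityBlockDoorLift

open Literature.MathematicalPhysics.QuantumFieldTheory.Balaban1983to89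
open Literature.MathematicalPhysics.QuantumFieldTheory.Balaban1983to89.T3ContinuumYM3Torus
open Literature.MathematicalPhysics.QuantumFieldTheory.Balaban1983to89.T3PrintedRegularMinimiser (RegPr)
open Literature.MathematicalPhysics.QuantumFieldTheory.Balaban1983to89.T3Thm1Carrier (Idx)
open T4Continuum BlockAveraging
open T3SectALandauChart (bgUnits eta eta_pos)
open B11Eq103H1Complex (BondL2K)
open B15DeterminingSets (embIter)
open Summit.QuantumFields.YangMills.Theorems.Prop8Chart (emlIterU)
open Summit.QuantumFields.YangMills.Theorems.Prop7SectET3Transport (periodsT3)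
open Summit.QuantumFields.YangMills.Theorems.Prop7SectET3HilbertLetters (W₂ toL2 DstarL2)
open Summit.QuantumFields.YangMills.Theorems.Prop7SectET3GaugeProjector (RS)
open Summit.QuantumFields.YangMills.Theorems.Prop7SectET3WilsonHessian (DeltaEta DeltaEtaSlot)
open Summit.QuantumFields.YangMills.Theorems.Prop7SectET3CurvedPropagators (Qk laplaceA)
open Summit.QuantumFields.YangMills.Theorems.Prop7SectET3DeltaPiPInv (DeltaPiSlotP)
open Summit.QuantumFields.YangMills.Theorems.Prop7SectET3DeltaOnePInv (DeltaOnePJ TJSlotP)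
open Summit.QuantumFields.YangMills.Theorems.Prop7PosOfGaugeFixed (pos_laplaceA_DeltaPiSlotP_iff pos_laplaceA_DeltaOnePJ_iff)
open Summit.QuantumFields.YangMills.Theorems.Prop7CoerciveRawSlotOfGaugeFixedLift (hPosΔ_lift_of_gaugeFixedRow gaugeFixedFloor_add_of_bound)
open Summit.QuantumFields.YangMills.Theorems.Prop7TJL2BoundOfSupRow (tauRow_TJP_of_supRow hTJtau_of_hTJsup)

/-- ★★★ **THE POSITIVITY BLOCK OF THE EX FACE, LIFT-THREAD 2 TEXTS, FROM THE γ-ROW + THE SUP-ROW `hTJ` + `hLiftRec` + WINDOWS.**  Conclusion = the conjunction of the three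
S43ᴸT2 binders `hPos₁` ∧ `hPosπ` ∧ `hPosΔ` (each: `∀ L > 1, ∀ i U₀ ρ, RegPr ρ U₀ → ρ ≤ αcap L → Lift L i U₀ → ∀ x ≠ 0, 0 < re⟨x, laplaceA … (slot) U₀ x⟩`, slots `DeltaOnePJ`,
`DeltaPiSlotP`, `DeltaEtaSlot + TJSlotP`). [cite: Balaban1985BackgroundPropagators, Thm 3.11 p.416, (3.118)–(3.122) pp.419–420, (3.127)–(3.128) p.421; Balaban1985Variational, (141)–(142) p.299] -/
theorem positivityRows_lift_of_gaugeFixedRow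
    (Lift : ∀ (L : ℕ) (i : Idx L), GaugeField (i.1.1.P i.1.2.2) 0 (Matrix.specialUnitaryGroup (Fin 2) ℂ) → Prop)
    (hLiftRec : ∀ (L : ℕ) (i : Idx L) (U₀ : GaugeField (i.1.1.P i.1.2.2) 0 (Matrix.specialUnitaryGroup (Fin 2) ℂ)), Lift L i U₀ →
      ∀ cf : Site (i.1.1.P i.1.2.2) (i.1.2.2 - i.1.2.1) → Matrix (Fin 2) (Fin 2) ℂ,
        (∀ e' : PBond (i.1.1.P i.1.2.2) (i.1.2.2 - i.1.2.1), cf e'.src = ((emlIterU (i.1.2.2 - i.1.2.1) (bgUnits i.1.1 i.1.2.2 U₀) e' : (Matrix (Fin 2) (Fin 2) ℂ)ˣ) : Matrix (Fin 2) (Fin 2) ℂ) * cf e'.tgt *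
          (((emlIterU (i.1.2.2 - i.1.2.1) (bgUnits i.1.1 i.1.2.2 U₀) e')⁻¹ : (Matrix (Fin 2) (Fin 2) ℂ)ˣ) : Matrix (Fin 2) (Fin 2) ℂ)) →
        ∃ l₀ : Site (i.1.1.P i.1.2.2) 0 → Matrix (Fin 2) (Fin 2) ℂ,
          (∀ b' : PBond (i.1.1.P i.1.2.2) 0, l₀ b'.src = ((bgUnits i.1.1 i.1.2.2 U₀ b' : (Matrix (Fin 2) (Fin 2) ℂ)ˣ) : Matrix (Fin 2) (Fin 2) ℂ) * l₀ b'.tgt * (((bgUnits i.1.1 i.1.2.2 U₀ b')⁻¹ : (Matrix (Fin 2) (Fin 2) ℂ)ˣ) : Matrix (Fin 2) (Fin 2) ℂ)) ∧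
          ∀ y : Site (i.1.1.P i.1.2.2) (i.1.2.2 - i.1.2.1), l₀ (embIter (i.1.2.2 - i.1.2.1) y) = cf y)
    (αcap : ℕ → ℝ) (hαcap : ∀ L : ℕ, 1 < L → 0 < αcap L) (hαW : ∀ L : ℕ, 1 < L → 10 ^ 12 * (L : ℝ) ^ 3 * αcap L ≤ 1)
    (c₀ cB : ℕ → ℝ) [hc₀ : ∀ L : ℕ, Fact (0 < c₀ L)] [hcB : ∀ L : ℕ, Fact (0 < cB L)]
    (a : ∀ L : ℕ, Idx L → ℝ) (ha : ∀ (L : ℕ) (i : Idx L), 0 < a L i)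
    (γ : ∀ L : ℕ, Idx L → ℝ) (kTJ : ℕ → ℝ) (hkTJ : ∀ L : ℕ, 1 < L → 0 ≤ kTJ L)
    (hwin₁ : ∀ (L : ℕ) (i : Idx L), 1 < L → 4 * kTJ L + 1029 * αcap L ≤ γ L i)
    (hwin₂ : ∀ (L : ℕ) (i : Idx L), 1 < L → 288 * αcap L ^ 2 + 4 * kTJ L ≤ 1)
    (hwin₃ : ∀ (L : ℕ) (i : Idx L), 1 < L → 4 * (1029 * αcap L) < min (γ L i - 4 * kTJ L - 1029 * αcap L) (1 - 288 * αcap L ^ 2 - 4 * kTJ L))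
    -- THE γ-ROW: the gauge-fixed slice floor of `Δ^η(U₀) + a·Q_k†Q_k` on `{R_S(U₀) D*_{U₀} A = 0}` ([B9] Thm 3.11 ∕ Thm 3.3 proper, in gauge-fixed form)
    (hGF : ∀ (L : ℕ), 1 < L → ∀ (i : Idx L) (U₀ : GaugeField (i.1.1.P i.1.2.2) 0 (Matrix.specialUnitaryGroup (Fin 2) ℂ)), ∀ ρ : ℝ,
      RegPr i.1.1 i.1.2.1 i.1.2.2 ρ U₀ → ρ ≤ αcap L →
        ∀ A : BondL2K ℂ 3 (periodsT3 i.1.1 i.1.2.2) (c₀ L) W₂,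
          RS i.1.1 i.1.2.1 i.1.2.2 i.2.2.le (c₀ L) (cB L) U₀ (DstarL2 i.1.1 i.1.2.1 i.1.2.2 (c₀ L) U₀ A) = 0 →
            γ L i * ‖A‖ ^ 2 ≤ RCLike.re ⟪A, DeltaEta i.1.1 i.1.2.1 i.1.2.2 (c₀ L) U₀ A⟫_ℂ + a L i * ‖Qk i.1.1 i.1.2.1 i.1.2.2 i.2.2.le (c₀ L) (cB L) U₀ A‖ ^ 2)
    -- THE SUP-ROW OF `T_Jᴾ` (S20ᴸ–S23ᴸ `hTJ` text at radius `αcap L`; ⟸ `h133` ∧ `hC157` by ✓`Prop7TJRowOfEntry157.hTJ_of_hHcol_h157`)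
    (hTJ : ∀ (L : ℕ), 1 < L → ∀ (i : Idx L) (U₀ : GaugeField (i.1.1.P i.1.2.2) 0 (Matrix.specialUnitaryGroup (Fin 2) ℂ)), RegPr i.1.1 i.1.2.1 i.1.2.2 (αcap L) U₀ →
      ∀ (X : PBond (i.1.1.P i.1.2.2) 0 → Matrix (Fin 2) (Fin 2) ℂ) (s : ℝ), (∀ bd, ‖X bd‖ ≤ s) →
        ∀ bd : PBond (i.1.1.P i.1.2.2) 0, ‖(toL2 i.1.1 i.1.2.2 (c₀ L)).symm (TJSlotP i.1.1 i.1.2.1 i.1.2.2 i.2.2.le (c₀ L) (cB L) (a L i) U₀ (toL2 i.1.1 i.1.2.2 (c₀ L) X)) bd‖ ≤ kTJ L * s) :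
    -- `hPos₁[Lift]`
    (∀ (L : ℕ), 1 < L → ∀ (i : Idx L) (U₀ : GaugeField (i.1.1.P i.1.2.2) 0 (Matrix.specialUnitaryGroup (Fin 2) ℂ)), ∀ ρ : ℝ, RegPr i.1.1 i.1.2.1 i.1.2.2 ρ U₀ → ρ ≤ αcap L →
      Lift L i U₀ →
      ∀ x : BondL2K ℂ 3 (periodsT3 i.1.1 i.1.2.2) (c₀ L) W₂, x ≠ 0 →
        0 < RCLike.re ⟪x, laplaceA i.1.1 i.1.2.1 i.1.2.2 i.2.2.le (c₀ L) (cB L) (a L i) (DeltaOnePJ i.1.1 i.1.2.1 i.1.2.2 i.2.2.le (c₀ L) (cB L) (a L i)) U₀ x⟫_ℂ) ∧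
    -- `hPosπ[Lift]`
    (∀ (L : ℕ), 1 < L → ∀ (i : Idx L) (U₀ : GaugeField (i.1.1.P i.1.2.2) 0 (Matrix.specialUnitaryGroup (Fin 2) ℂ)), ∀ ρ : ℝ, RegPr i.1.1 i.1.2.1 i.1.2.2 ρ U₀ → ρ ≤ αcap L →
      Lift L i U₀ →
      ∀ x : BondL2K ℂ 3 (periodsT3 i.1.1 i.1.2.2) (c₀ L) W₂, x ≠ 0 →
        0 < RCLike.re ⟪x, laplaceA i.1.1 i.1.2.1 i.1.2.2 i.2.2.le (c₀ L) (cB L) (a L i) (DeltaPiSlotP i.1.1 i.1.2.1 i.1.2.2 i.2.2.le (c₀ L) (cB L) (a L i)) U₀ x⟫_ℂ) ∧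
    -- `hPosΔ[Lift]`
    (∀ (L : ℕ), 1 < L → ∀ (i : Idx L) (U₀ : GaugeField (i.1.1.P i.1.2.2) 0 (Matrix.specialUnitaryGroup (Fin 2) ℂ)), ∀ ρ : ℝ, RegPr i.1.1 i.1.2.1 i.1.2.2 ρ U₀ → ρ ≤ αcap L →
      Lift L i U₀ →
      ∀ x : BondL2K ℂ 3 (periodsT3 i.1.1 i.1.2.2) (c₀ L) W₂, x ≠ 0 →
        0 < RCLike.re ⟪x, laplaceA i.1.1 i.1.2.1 i.1.2.2 i.2.2.le (c₀ L) (cB L) (a L i) ((DeltaEtaSlot i.1.1 i.1.2.1 i.1.2.2 (c₀ L) + TJSlotP i.1.1 i.1.2.1 i.1.2.2 i.2.2.le (c₀ L) (cB L) (a L i))) U₀ x⟫_ℂ) := by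
  -- the τ-row from the sup-row (symmetry of `T_Jᴾ` on `RegPr`)
  have hτ : ∀ (L : ℕ), 1 < L → ∀ (i : Idx L) (U₀ : GaugeField (i.1.1.P i.1.2.2) 0 (Matrix.specialUnitaryGroup (Fin 2) ℂ)), ∀ ρ : ℝ,
      RegPr i.1.1 i.1.2.1 i.1.2.2 ρ U₀ → ρ ≤ αcap L →
        ∀ u v : BondL2K ℂ 3 (periodsT3 i.1.1 i.1.2.2) (c₀ L) W₂,
          ‖⟪u, TJSlotP i.1.1 i.1.2.1 i.1.2.2 i.2.2.le (c₀ L) (cB L) (a L i) U₀ v⟫_ℂ‖ ≤ kTJ L * ‖u‖ * ‖v‖ :=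
    hTJtau_of_hTJsup αcap hαcap hαW c₀ cB a ha kTJ hkTJ hTJ
  -- the slice floor `γ − kTJ` at slot `Δ^η + T_J`
  have hGF₁ : ∀ (L : ℕ), 1 < L → ∀ (i : Idx L) (U₀ : GaugeField (i.1.1.P i.1.2.2) 0 (Matrix.specialUnitaryGroup (Fin 2) ℂ)), ∀ ρ : ℝ,
      RegPr i.1.1 i.1.2.1 i.1.2.2 ρ U₀ → ρ ≤ αcap L →
        ∀ A : BondL2K ℂ 3 (periodsT3 i.1.1 i.1.2.2) (c₀ L) W₂,
          RS i.1.1 i.1.2.1 i.1.2.2 i.2.2.le (c₀ L) (cB L) U₀ (DstarL2 i.1.1 i.1.2.1 i.1.2.2 (c₀ L) U₀ A) = 0 →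
            (γ L i - kTJ L) * ‖A‖ ^ 2 ≤ RCLike.re ⟪A, DeltaEta i.1.1 i.1.2.1 i.1.2.2 (c₀ L) U₀ A
                + TJSlotP i.1.1 i.1.2.1 i.1.2.2 i.2.2.le (c₀ L) (cB L) (a L i) U₀ A⟫_ℂ + a L i * ‖Qk i.1.1 i.1.2.1 i.1.2.2 i.2.2.le (c₀ L) (cB L) U₀ A‖ ^ 2 :=
    fun L hL i U₀ ρ hreg hρ =>
      gaugeFixedFloor_add_of_bound i.1.1 (h := i.2.2.le) (a := a L i) (fun U => TJSlotP i.1.1 i.1.2.1 i.1.2.2 i.2.2.le (c₀ L) (cB L) (a L i) U) U₀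
        (hτ L hL i U₀ ρ hreg hρ) (hGF L hL i U₀ ρ hreg hρ)
  refine ⟨?_, ?_, ?_⟩
  · -- `hPos₁`: slice positivity at `Δ^η + T_J` (floor `γ − kTJ > 0`)
    intro L hL i U₀ ρ hreg hρ _ x hx
    refine (pos_laplaceA_DeltaOnePJ_iff (ha L i).le U₀).2 (fun A hA hR => ?_) x hx
    have h1 := hGF₁ L hL i U₀ ρ hreg hρ A hR
    have hγ : 0 < γ L i - kTJ L := by
      have := hwin₁ L i hL; have := hkTJ L hL; have := hαcap L hL; linarith
    exact lt_of_lt_of_le (mul_pos hγ (pow_pos (norm_pos_iff.2 hA) 2)) h1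
  · -- `hPosπ`: slice positivity at `Δ^η` (floor `γ > 0`)
    intro L hL i U₀ ρ hreg hρ _ x hx
    refine (pos_laplaceA_DeltaPiSlotP_iff (ha L i).le U₀).2 (fun A hA hR => ?_) x hx
    have h1 := hGF L hL i U₀ ρ hreg hρ A hR
    have hγ : 0 < γ L i := by
      have := hwin₁ L i hL; have := hkTJ L hL; have := hαcap L hL; linarith
    exact lt_of_lt_of_le (mul_pos hγ (pow_pos (norm_pos_iff.2 hA) 2)) h1
  · -- `hPosΔ`: the raw-slot row behind `Lift` (τ := max (kTJ L) 0, = kTJ L for L > 1)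
    have hτ' : ∀ (L : ℕ), 1 < L → ∀ (i : Idx L) (U₀ : GaugeField (i.1.1.P i.1.2.2) 0 (Matrix.specialUnitaryGroup (Fin 2) ℂ)), ∀ ρ : ℝ,
        RegPr i.1.1 i.1.2.1 i.1.2.2 ρ U₀ → ρ ≤ αcap L →
          ∀ u v : BondL2K ℂ 3 (periodsT3 i.1.1 i.1.2.2) (c₀ L) W₂,
            ‖⟪u, TJSlotP i.1.1 i.1.2.1 i.1.2.2 i.2.2.le (c₀ L) (cB L) (a L i) U₀ v⟫_ℂ‖ ≤ max (kTJ L) 0 * ‖u‖ * ‖v‖ := by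
      intro L hL i U₀ ρ hreg hρ u v
      rw [max_eq_left (hkTJ L hL)]
      exact hτ L hL i U₀ ρ hreg hρ u v
    have hw₁ : ∀ (L : ℕ) (i : Idx L), 1 < L → 3 * max (kTJ L) 0 + 1029 * αcap L ≤ γ L i - kTJ L := by
      intro L i hL; rw [max_eq_left (hkTJ L hL)]; have := hwin₁ L i hL; linarith
    have hw₂ : ∀ (L : ℕ) (i : Idx L), 1 < L → 288 * αcap L ^ 2 + 4 * max (kTJ L) 0 ≤ 1 := by
      intro L i hL; rw [max_eq_left (hkTJ L hL)]; exact hwin₂ L i hL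
    have hw₃ : ∀ (L : ℕ) (i : Idx L), 1 < L →
        4 * (1029 * αcap L) < min (γ L i - kTJ L - 3 * max (kTJ L) 0 - 1029 * αcap L) (1 - 288 * αcap L ^ 2 - 4 * max (kTJ L) 0) := by
      intro L i hL
      rw [max_eq_left (hkTJ L hL)]
      have e : γ L i - kTJ L - 3 * kTJ L - 1029 * αcap L = γ L i - 4 * kTJ L - 1029 * αcap L := by ring
      rw [e]; exact hwin₃ L i hL
    exact hPosΔ_lift_of_gaugeFixedRow Lift hLiftRec αcap hαcap hαW c₀ cB a ha (fun L i => γ L i - kTJ L) (fun L _ => max (kTJ L) 0)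
      (fun L _ => le_max_right _ _) hw₁ hw₂ hw₃ hτ' hGF₁

/-- ★★★ **THE SAME DOOR AT THE LIFT TEXT OF RECORD** (`Lift :=` the lifting predicate of ✓`Prop7IrrLiftRowOfRecord.hIrrLift_of_record`, `hLiftRec := fun _ _ _ h => h`): the three
conjuncts are then the S43ᴸT2 binders `hPos₁` ∧ `hPosπ` ∧ `hPosΔ` VERBATIM (SIGNATURE-0 `…S43LT2-LiftThread2-face` ll.141–170: the `Lift` clause spelled out after `ρ ≤ αcap L →`).
[cite: Balaban1985BackgroundPropagators, Thm 3.11 p.416, (3.118)–(3.122) pp.419–420, (3.127)–(3.128) p.421; Balaban1985Variational, (141)–(142) p.299] -/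
theorem positivityRows_liftRecord_of_gaugeFixedRow
    (αcap : ℕ → ℝ) (hαcap : ∀ L : ℕ, 1 < L → 0 < αcap L) (hαW : ∀ L : ℕ, 1 < L → 10 ^ 12 * (L : ℝ) ^ 3 * αcap L ≤ 1)
    (c₀ cB : ℕ → ℝ) [hc₀ : ∀ L : ℕ, Fact (0 < c₀ L)] [hcB : ∀ L : ℕ, Fact (0 < cB L)]
    (a : ∀ L : ℕ, Idx L → ℝ) (ha : ∀ (L : ℕ) (i : Idx L), 0 < a L i)
    (γ : ∀ L : ℕ, Idx L → ℝ) (kTJ : ℕ → ℝ) (hkTJ : ∀ L : ℕ, 1 < L → 0 ≤ kTJ L)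
    (hwin₁ : ∀ (L : ℕ) (i : Idx L), 1 < L → 4 * kTJ L + 1029 * αcap L ≤ γ L i)
    (hwin₂ : ∀ (L : ℕ) (i : Idx L), 1 < L → 288 * αcap L ^ 2 + 4 * kTJ L ≤ 1)
    (hwin₃ : ∀ (L : ℕ) (i : Idx L), 1 < L → 4 * (1029 * αcap L) < min (γ L i - 4 * kTJ L - 1029 * αcap L) (1 - 288 * αcap L ^ 2 - 4 * kTJ L))
    (hGF : ∀ (L : ℕ), 1 < L → ∀ (i : Idx L) (U₀ : GaugeField (i.1.1.P i.1.2.2) 0 (Matrix.specialUnitaryGroup (Fin 2) ℂ)), ∀ ρ : ℝ,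
      RegPr i.1.1 i.1.2.1 i.1.2.2 ρ U₀ → ρ ≤ αcap L →
        ∀ A : BondL2K ℂ 3 (periodsT3 i.1.1 i.1.2.2) (c₀ L) W₂,
          RS i.1.1 i.1.2.1 i.1.2.2 i.2.2.le (c₀ L) (cB L) U₀ (DstarL2 i.1.1 i.1.2.1 i.1.2.2 (c₀ L) U₀ A) = 0 →
            γ L i * ‖A‖ ^ 2 ≤ RCLike.re ⟪A, DeltaEta i.1.1 i.1.2.1 i.1.2.2 (c₀ L) U₀ A⟫_ℂ + a L i * ‖Qk i.1.1 i.1.2.1 i.1.2.2 i.2.2.le (c₀ L) (cB L) U₀ A‖ ^ 2)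
    (hTJ : ∀ (L : ℕ), 1 < L → ∀ (i : Idx L) (U₀ : GaugeField (i.1.1.P i.1.2.2) 0 (Matrix.specialUnitaryGroup (Fin 2) ℂ)), RegPr i.1.1 i.1.2.1 i.1.2.2 (αcap L) U₀ →
      ∀ (X : PBond (i.1.1.P i.1.2.2) 0 → Matrix (Fin 2) (Fin 2) ℂ) (s : ℝ), (∀ bd, ‖X bd‖ ≤ s) →
        ∀ bd : PBond (i.1.1.P i.1.2.2) 0, ‖(toL2 i.1.1 i.1.2.2 (c₀ L)).symm (TJSlotP i.1.1 i.1.2.1 i.1.2.2 i.2.2.le (c₀ L) (cB L) (a L i) U₀ (toL2 i.1.1 i.1.2.2 (c₀ L) X)) bd‖ ≤ kTJ L * s) :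
    -- `hPos₁` (S43ᴸT2 ll.141–150)
    (∀ (L : ℕ), 1 < L → ∀ (i : Idx L) (U₀ : GaugeField (i.1.1.P i.1.2.2) 0 (Matrix.specialUnitaryGroup (Fin 2) ℂ)), ∀ ρ : ℝ, RegPr i.1.1 i.1.2.1 i.1.2.2 ρ U₀ → ρ ≤ αcap L →
        (∀ cf : Site (i.1.1.P i.1.2.2) (i.1.2.2 - i.1.2.1) → Matrix (Fin 2) (Fin 2) ℂ,
        (∀ e' : PBond (i.1.1.P i.1.2.2) (i.1.2.2 - i.1.2.1), cf e'.src = ((emlIterU (i.1.2.2 - i.1.2.1) (bgUnits i.1.1 i.1.2.2 U₀) e' : (Matrix (Fin 2) (Fin 2) ℂ)ˣ) : Matrix (Fin 2) (Fin 2) ℂ) * cf e'.tgt *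
        (((emlIterU (i.1.2.2 - i.1.2.1) (bgUnits i.1.1 i.1.2.2 U₀) e')⁻¹ : (Matrix (Fin 2) (Fin 2) ℂ)ˣ) : Matrix (Fin 2) (Fin 2) ℂ)) →
        ∃ l₀ : Site (i.1.1.P i.1.2.2) 0 → Matrix (Fin 2) (Fin 2) ℂ,
        (∀ b' : PBond (i.1.1.P i.1.2.2) 0, l₀ b'.src = ((bgUnits i.1.1 i.1.2.2 U₀ b' : (Matrix (Fin 2) (Fin 2) ℂ)ˣ) : Matrix (Fin 2) (Fin 2) ℂ) * l₀ b'.tgt * (((bgUnits i.1.1 i.1.2.2 U₀ b')⁻¹ : (Matrix (Fin 2) (Fin 2) ℂ)ˣ) : Matrix (Fin 2) (Fin 2) ℂ)) ∧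
        ∀ y : Site (i.1.1.P i.1.2.2) (i.1.2.2 - i.1.2.1), l₀ (embIter (i.1.2.2 - i.1.2.1) y) = cf y) →
      ∀ x : BondL2K ℂ 3 (periodsT3 i.1.1 i.1.2.2) (c₀ L) W₂, x ≠ 0 →
        0 < RCLike.re ⟪x, laplaceA i.1.1 i.1.2.1 i.1.2.2 i.2.2.le (c₀ L) (cB L) (a L i) (DeltaOnePJ i.1.1 i.1.2.1 i.1.2.2 i.2.2.le (c₀ L) (cB L) (a L i)) U₀ x⟫_ℂ) ∧
    -- `hPosπ` (ll.151–160)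
    (∀ (L : ℕ), 1 < L → ∀ (i : Idx L) (U₀ : GaugeField (i.1.1.P i.1.2.2) 0 (Matrix.specialUnitaryGroup (Fin 2) ℂ)), ∀ ρ : ℝ, RegPr i.1.1 i.1.2.1 i.1.2.2 ρ U₀ → ρ ≤ αcap L →
        (∀ cf : Site (i.1.1.P i.1.2.2) (i.1.2.2 - i.1.2.1) → Matrix (Fin 2) (Fin 2) ℂ,
        (∀ e' : PBond (i.1.1.P i.1.2.2) (i.1.2.2 - i.1.2.1), cf e'.src = ((emlIterU (i.1.2.2 - i.1.2.1) (bgUnits i.1.1 i.1.2.2 U₀) e' : (Matrix (Fin 2) (Fin 2) ℂ)ˣ) : Matrix (Fin 2) (Fin 2) ℂ) * cf e'.tgt *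
        (((emlIterU (i.1.2.2 - i.1.2.1) (bgUnits i.1.1 i.1.2.2 U₀) e')⁻¹ : (Matrix (Fin 2) (Fin 2) ℂ)ˣ) : Matrix (Fin 2) (Fin 2) ℂ)) →
        ∃ l₀ : Site (i.1.1.P i.1.2.2) 0 → Matrix (Fin 2) (Fin 2) ℂ,
        (∀ b' : PBond (i.1.1.P i.1.2.2) 0, l₀ b'.src = ((bgUnits i.1.1 i.1.2.2 U₀ b' : (Matrix (Fin 2) (Fin 2) ℂ)ˣ) : Matrix (Fin 2) (Fin 2) ℂ) * l₀ b'.tgt * (((bgUnits i.1.1 i.1.2.2 U₀ b')⁻¹ : (Matrix (Fin 2) (Fin 2) ℂ)ˣ) : Matrix (Fin 2) (Fin 2) ℂ)) ∧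
        ∀ y : Site (i.1.1.P i.1.2.2) (i.1.2.2 - i.1.2.1), l₀ (embIter (i.1.2.2 - i.1.2.1) y) = cf y) →
      ∀ x : BondL2K ℂ 3 (periodsT3 i.1.1 i.1.2.2) (c₀ L) W₂, x ≠ 0 →
        0 < RCLike.re ⟪x, laplaceA i.1.1 i.1.2.1 i.1.2.2 i.2.2.le (c₀ L) (cB L) (a L i) (DeltaPiSlotP i.1.1 i.1.2.1 i.1.2.2 i.2.2.le (c₀ L) (cB L) (a L i)) U₀ x⟫_ℂ) ∧
    -- `hPosΔ` (ll.161–170)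
    (∀ (L : ℕ), 1 < L → ∀ (i : Idx L) (U₀ : GaugeField (i.1.1.P i.1.2.2) 0 (Matrix.specialUnitaryGroup (Fin 2) ℂ)), ∀ ρ : ℝ, RegPr i.1.1 i.1.2.1 i.1.2.2 ρ U₀ → ρ ≤ αcap L →
        (∀ cf : Site (i.1.1.P i.1.2.2) (i.1.2.2 - i.1.2.1) → Matrix (Fin 2) (Fin 2) ℂ,
        (∀ e' : PBond (i.1.1.P i.1.2.2) (i.1.2.2 - i.1.2.1), cf e'.src = ((emlIterU (i.1.2.2 - i.1.2.1) (bgUnits i.1.1 i.1.2.2 U₀) e' : (Matrix (Fin 2) (Fin 2) ℂ)ˣ) : Matrix (Fin 2) (Fin 2) ℂ) * cf e'.tgt *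
        (((emlIterU (i.1.2.2 - i.1.2.1) (bgUnits i.1.1 i.1.2.2 U₀) e')⁻¹ : (Matrix (Fin 2) (Fin 2) ℂ)ˣ) : Matrix (Fin 2) (Fin 2) ℂ)) →
        ∃ l₀ : Site (i.1.1.P i.1.2.2) 0 → Matrix (Fin 2) (Fin 2) ℂ,
        (∀ b' : PBond (i.1.1.P i.1.2.2) 0, l₀ b'.src = ((bgUnits i.1.1 i.1.2.2 U₀ b' : (Matrix (Fin 2) (Fin 2) ℂ)ˣ) : Matrix (Fin 2) (Fin 2) ℂ) * l₀ b'.tgt * (((bgUnits i.1.1 i.1.2.2 U₀ b')⁻¹ : (Matrix (Fin 2) (Fin 2) ℂ)ˣ) : Matrix (Fin 2) (Fin 2) ℂ)) ∧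
        ∀ y : Site (i.1.1.P i.1.2.2) (i.1.2.2 - i.1.2.1), l₀ (embIter (i.1.2.2 - i.1.2.1) y) = cf y) →
      ∀ x : BondL2K ℂ 3 (periodsT3 i.1.1 i.1.2.2) (c₀ L) W₂, x ≠ 0 →
        0 < RCLike.re ⟪x, laplaceA i.1.1 i.1.2.1 i.1.2.2 i.2.2.le (c₀ L) (cB L) (a L i) ((DeltaEtaSlot i.1.1 i.1.2.1 i.1.2.2 (c₀ L) + TJSlotP i.1.1 i.1.2.1 i.1.2.2 i.2.2.le (c₀ L) (cB L) (a L i))) U₀ x⟫_ℂ) :=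
  positivityRows_lift_of_gaugeFixedRow
    (fun _ i U₀ => ∀ cf : Site (i.1.1.P i.1.2.2) (i.1.2.2 - i.1.2.1) → Matrix (Fin 2) (Fin 2) ℂ,
        (∀ e' : PBond (i.1.1.P i.1.2.2) (i.1.2.2 - i.1.2.1), cf e'.src = ((emlIterU (i.1.2.2 - i.1.2.1) (bgUnits i.1.1 i.1.2.2 U₀) e' : (Matrix (Fin 2) (Fin 2) ℂ)ˣ) : Matrix (Fin 2) (Fin 2) ℂ) * cf e'.tgt *
        (((emlIterU (i.1.2.2 - i.1.2.1) (bgUnits i.1.1 i.1.2.2 U₀) e')⁻¹ : (Matrix (Fin 2) (Fin 2) ℂ)ˣ) : Matrix (Fin 2) (Fin 2) ℂ)) →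
        ∃ l₀ : Site (i.1.1.P i.1.2.2) 0 → Matrix (Fin 2) (Fin 2) ℂ,
        (∀ b' : PBond (i.1.1.P i.1.2.2) 0, l₀ b'.src = ((bgUnits i.1.1 i.1.2.2 U₀ b' : (Matrix (Fin 2) (Fin 2) ℂ)ˣ) : Matrix (Fin 2) (Fin 2) ℂ) * l₀ b'.tgt * (((bgUnits i.1.1 i.1.2.2 U₀ b')⁻¹ : (Matrix (Fin 2) (Fin 2) ℂ)ˣ) : Matrix (Fin 2) (Fin 2) ℂ)) ∧
        ∀ y : Site (i.1.1.P i.1.2.2) (i.1.2.2 - i.1.2.1), l₀ (embIter (i.1.2.2 - i.1.2.1) y) = cf y)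
    (fun _ _ _ hl => hl) αcap hαcap hαW c₀ cB a ha γ kTJ hkTJ hwin₁ hwin₂ hwin₃ hGF hTJ

end Summit.QuantumFields.YangMills.Theorems.Prop7PositivityBlockDoorLift

end
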